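import Summits.AtomisticToContinuum.HydrodynamicLimit.Theses.InformationPercolationEngine
import Summits.AtomisticToContinuum.HydrodynamicLimit.Theorems.KickIsotropyInfo.Negative.KickIsotropyInfoFalseOfShieldingBiasPersists
import Literature.MathematicalPhysics.KineticTheory.HardSphereTwoTimePressure

/-!
# `KickFluxFairMeso` is false modulo the third-body shielding bias:
# `ShieldingBiasPersists → ¬ KickFluxFairMeso` (negative lemma modulo `H`)

Negative knowledge for the registered stub
`stub_kickScoreNeutrality : KickFairRelEquilibriumMeso → KickFluxFairMeso` of line `ideator2-Sketch`
(card `impact-disc-flattening`) of the crux `PercolationClosesChaos` (stmt-AtomisticToContinuum-15178),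
skeleton `Cruxes/PercolationClosesChaos/Lines/ideator2_Sketch.lean` §3/§4.

* §1 `fluxAvg`, `fluxMean`, `KickFluxFairMeso` — VERBATIM copies of the skeleton's §3 (the stub's
  CONCLUSION: kicks are ABSOLUTELY flux-fair given the mesoscopic coarse past, uniformly over general
  past-measurable weights, along some admissible cell sequence `rs`). The skeleton (a `Cruxes/` work file
  with sorries) is not importable from `Theorems/`; with both in scope the two `KickFluxFairMeso` agree by
  `Iff.rfl`.
* §2 `kickFluxSum` / `kickFluxFairMeso_iff` — the let-chain packaged (`Iff.rfl`), as
  `KickIsotropyInfoNegative.kickIsotropyInfo_iff` does for the rev-1–3 crux.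
* §3 the reduction to the shielding witness of
  `Theorems/KickIsotropyInfo/Negative/KickIsotropyInfoFalseOfShieldingBiasPersists.lean`:
  (i) the shielding kick test `kickTest c κ` has flux mean `0` at every `(v, w)` (`fluxMean_kickTest`, from
  `zeroFluxMean_kickTest`), so the compensator vanishes identically; (ii) the shielding weight reads only the
  exact velocities at the two flight starts and the partner label, NOT the cells, so it takes the same value
  on the `rs N`-coarse past as on any `r`-coarse past (`shieldWeight_coarsePastOf_eq`, definitional); hence
  (iii) on the good set of the flow the skeleton's compensated sum with weight `p ↦ shieldWeight … p.1` IS the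
  shielding collision sum `kickSum … (kickTest c κ) (shieldWeight c K N)` (`kickFluxSum_eq_kickSum`), and the
  good set is conull for every local Gibbs law (`ae_mem_good_localGibbsLaw`), so the two `L¹` norms agree
  (`lintegral_kickFluxSum_eq`).
* §4 THE NEGATIVE LEMMA `KickFluxFairMeso_false_of_ShieldingBiasPersists : H → ¬ KickFluxFairMeso` with
  `H = KickIsotropyInfoNegative.ShieldingBiasPersists` (p84825's hypothesis, assumed — never proved — here):
  specialise `KickFluxFairMeso` to the invariant law (`a₀ = θ₀ = 1`, `u₀ = 0`), to `H`'s `σ, Φ, τ`, the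
  admissible test `kickTest c κ` (continuous, `|g| ≤ 1`) and the admissible weight `p ↦ shieldWeight c K N i n p.1`
  (measurable, `|h| ≤ 1`); by §3 the bound it delivers is `KickBound σ 1 1 0 N (Φ N) τ r (kickTest c κ)
  (shieldWeight c K N) δ` for all large `N`, which `H` denies for infinitely many `N`. The cell sequence `rs`
  never enters: the witness reads no cells, so `H` refutes the absolute mesoscopic form along EVERY `rs`.

WHY. In the line's composition, step (1) replaces each kick test `Ψ(ω,v,w)` by its flux mean `Ψ̄(v,w)`
collision by collision; the crux hypothesis K (relative fairness, `g − E_G[g | past]`) plus the card's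
"KickScoreNeutrality" (`E_G[g | past] ↦` flux mean) is exactly absolute flux-fairness = `KickFluxFairMeso`. But
absolute fairness given a past containing the exact velocities at the two flight starts is what the rev-1–3 crux
`KickIsotropyInfo` asserted at fixed cells, held under `KickIsotropyInfo_false_of_ShieldingBiasPersists`
(third-body shielding: an `O(φ)` conditional kick bias present already under the INVARIANT law; MD kit j004861
`T = +0.0178 ± 0.0004` at `φ = 0.05`). No statement of the route is asserted here positively; `H` is a hypothesis.
-/

noncomputable section

open MeasureTheory Set Filter Topology
open scoped ENNReal BigOperators Classical InnerProductSpace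
open Literature.Analysis.FluidPDE Literature.MathematicalPhysics.KineticTheory
open Summit.AtomisticToContinuum.HydrodynamicLimit.Theses.InformationPercolationEngine
open Summit.AtomisticToContinuum.HydrodynamicLimit.Theorems.KickIsotropyInfoNegative

namespace Summit.AtomisticToContinuum.HydrodynamicLimit.Theorems.PercolationClosesChaos.Negative

/-! ## §1 The stub's conclusion, verbatim -/

/-- Flux-angular integral of a mark test `Ξ(ω, v, w)` over impact vectors at incoming velocities `(v, w)`:
`∫_{S²} Ξ(ω, v, w) ((w − v)·ω)₊ dω` (the target's `Θ`; `hardSphereKernel (w, v) ω = ((w − v)·ω)₊`). Verbatim copy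
of `ImpactDiscFlatteningLine.fluxAvg` of the skeleton `Cruxes/PercolationClosesChaos/Lines/ideator2_Sketch.lean` §3. -/
def fluxAvg (Ξ : V3 × V3 × V3 → ℝ) (v w : V3) : ℝ :=
  ∫ ω : Metric.sphere (0 : V3) 1, Ξ ((ω : V3), v, w) * hardSphereKernel (w, v) ω ∂sphereMeasure

/-- The FLUX MEAN of a kick test `g` at incoming velocities `(v, w)`: `Θ_g(v,w)/Θ_1(v,w)` — the mean of
`g(ω, v, w)` under the flux law `∝ ((w − v)·ω)₊ dω` of the impact vector (junk `0` at `v = w`). Verbatim copy of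
`ImpactDiscFlatteningLine.fluxMean` of the skeleton `Cruxes/PercolationClosesChaos/Lines/ideator2_Sketch.lean` §3. -/
def fluxMean (g : V3 × V3 × V3 → ℝ) (vw : V3 × V3) : ℝ :=
  (fluxAvg (fun _ => 1) vw.1 vw.2)⁻¹ * fluxAvg g vw.1 vw.2

/-- `KickFluxFairMeso` — KICKS ARE FLUX-FAIR GIVEN THE MESOSCOPIC COARSE PAST (absolute form): the let-chain of
`KickFairRelEquilibriumMeso` VERBATIM (same cell sequence quantifier `∃ rs` with the typed lower edge, same past `P`,
same marks `X = (ω, v⁻, v*⁻)`, same weights `h`, same good-set cut), with the equilibrium conditional mean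
`κ_{i,n} = E_G[g(X) | σ(P)]` replaced by the FLUX MEAN `fluxMean g (v⁻, v*⁻)`: the compensated kick sum
`(ε/(N+1)) Σ_i Σ_{n < cnt} h_{i,n}(P)·(g(X_{i,n}) − Θ_g/Θ_1(v⁻_{i,n}, v*⁻_{i,n}))` has `L¹(localGibbsLaw)` norm
`≤ δ`. VERBATIM COPY of the registered stub conclusion `ImpactDiscFlatteningLine.KickFluxFairMeso` of line
`ideator2-Sketch` (skeleton `Cruxes/PercolationClosesChaos/Lines/ideator2_Sketch.lean` §3, the conclusion of
`stub_kickScoreNeutrality`), equal to it by `Iff.rfl` when both are in scope (the skeleton is a `Cruxes/` work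
file and cannot be imported here). Refuted below modulo `ShieldingBiasPersists`. -/
def KickFluxFairMeso : Prop :=
  ∃ rs : ℕ → ℝ, (∀ N, 0 < rs N) ∧ Filter.Tendsto rs Filter.atTop (nhds 0) ∧
    Filter.Tendsto (fun N : ℕ => ((N : ℝ) + 1) * rs N ^ 3) Filter.atTop Filter.atTop ∧
    ∀ (a₀ θ₀ : T3 → ℝ) (u₀ : T3 → V3), Continuous a₀ → Continuous θ₀ → Continuous u₀ → (∀ x, 0 < a₀ x) →
    (∀ x, 0 < θ₀ x) → ∃ σ₀ : ℝ, 0 < σ₀ ∧ ∀ σ : ℝ, 0 < σ → σ < σ₀ →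
    ∀ Φ : (N : ℕ) → HardSphereFlow (Torus.geometry (Fin 3)) (hsDiameter σ N) (N + 1), ∀ τ : ℝ, 0 < τ →
    ∀ g : V3 × V3 × V3 → ℝ, Continuous g → (∃ C : ℝ, ∀ p, |g p| ≤ C) → ∀ δ : ℝ, 0 < δ → ∃ N₀ : ℕ, ∀ N : ℕ, N₀ ≤ N →
    ∀ h : Fin (N + 1) → ℕ → (((Fin (N + 1) → (Fin 3 → ℤ) × V3) × (Fin (N + 1) → (Fin 3 → ℤ) × V3)) × Fin (N + 1)) ×
      (ℝ × ℝ × ℝ) → ℝ, (∀ i n, Measurable (h i n)) → (∀ i n p, |h i n p| ≤ 1) →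
    let ε := hsDiameter σ N
    let G : Geometry (Fin 3) T3 := Torus.geometry (Fin 3)
    let q : T3 → (Fin 3 → ℤ) := Torus.coarseCell (rs N)
    let γ : Config (N + 1) (Fin 3) T3 → ℝ → Config (N + 1) (Fin 3) T3 := fun z s => (Φ N).flow s z
    let cnt : Config (N + 1) (Fin 3) T3 → Fin (N + 1) → ℕ := fun z i =>
      Set.ncard (collisionTimesOf G ε (γ z) i ∩ Set.Ioc 0 τ)
    let P : Config (N + 1) (Fin 3) T3 → Fin (N + 1) → ℕ →
        (((Fin (N + 1) → (Fin 3 → ℤ) × V3) × (Fin (N + 1) → (Fin 3 → ℤ) × V3)) × Fin (N + 1)) × (ℝ × ℝ × ℝ) :=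
      fun z i n => if z ∈ (Φ N).good then
        (((Φ N).coarsePastOf q i n z, (Φ N).nthPartnerOf i n z),
          (flightStart G ε (γ z) 0 i ((Φ N).nthCollisionTimeOf i n z),
            flightStart G ε (γ z) 0 ((Φ N).nthPartnerOf i n z) ((Φ N).nthCollisionTimeOf i n z),
            (Φ N).nthCollisionTimeOf i n z))
        else (((fun _ => (0, 0), fun _ => (0, 0)), 0), (0, 0, 0))
    let X : Fin (N + 1) → ℕ → Config (N + 1) (Fin 3) T3 → V3 × V3 × V3 := fun i n z =>
      if z ∈ (Φ N).good then (((Φ N).nthRecordOf i n z).impactVec, ((Φ N).nthRecordOf i n z).preVel) else 0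
    let S : Config (N + 1) (Fin 3) T3 → ℝ := fun z =>
      ε / (N + 1 : ℝ) * ∑ i : Fin (N + 1), ∑ n ∈ Finset.range (cnt z i),
        h i n (P z i n) * (g (X i n z) - fluxMean g (X i n z).2)
    ∫⁻ z, ENNReal.ofReal |S z| ∂(localGibbsLaw σ a₀ u₀ θ₀ N (Φ N)) ≤ ENNReal.ofReal δ

/-! ## §2 The conclusion, repackaged (definitionally) -/

/-- The compensated, normalised, weighted kick sum `S` of `KickFluxFairMeso` (its `let`-chain, verbatim) at
reduced density `σ`, size `N + 1`, flow `Φ`, horizon `τ`, cell size `ρ`, kick test `g` and weights `h` on the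
typed past `Past N × (ℝ × ℝ × ℝ)` (coarse past and partner label, the two flight-start times, the collision time). -/
def kickFluxSum (σ : ℝ) (N : ℕ) (Φ : Flow σ N) (τ ρ : ℝ) (g : V3 × V3 × V3 → ℝ)
    (h : Fin (N + 1) → ℕ → Past N × (ℝ × ℝ × ℝ) → ℝ) (z : Config (N + 1) (Fin 3) T3) : ℝ :=
  let ε := hsDiameter σ N
  let G : Geometry (Fin 3) T3 := Torus.geometry (Fin 3)
  let q : T3 → (Fin 3 → ℤ) := Torus.coarseCell ρ
  let γ : Config (N + 1) (Fin 3) T3 → ℝ → Config (N + 1) (Fin 3) T3 := fun z s => Φ.flow s z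
  let cnt : Config (N + 1) (Fin 3) T3 → Fin (N + 1) → ℕ := fun z i =>
    Set.ncard (collisionTimesOf G ε (γ z) i ∩ Set.Ioc 0 τ)
  let P : Config (N + 1) (Fin 3) T3 → Fin (N + 1) → ℕ → Past N × (ℝ × ℝ × ℝ) :=
    fun z i n => if z ∈ Φ.good then
      ((Φ.coarsePastOf q i n z, Φ.nthPartnerOf i n z),
        (flightStart G ε (γ z) 0 i (Φ.nthCollisionTimeOf i n z),
          flightStart G ε (γ z) 0 (Φ.nthPartnerOf i n z) (Φ.nthCollisionTimeOf i n z),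
          Φ.nthCollisionTimeOf i n z))
      else (((fun _ => (0, 0), fun _ => (0, 0)), 0), (0, 0, 0))
  let X : Fin (N + 1) → ℕ → Config (N + 1) (Fin 3) T3 → V3 × V3 × V3 := fun i n z =>
    if z ∈ Φ.good then ((Φ.nthRecordOf i n z).impactVec, (Φ.nthRecordOf i n z).preVel) else 0
  ε / (N + 1 : ℝ) * ∑ i : Fin (N + 1), ∑ n ∈ Finset.range (cnt z i),
    h i n (P z i n) * (g (X i n z) - fluxMean g (X i n z).2)

/-- **Faithful restatement.** `KickFluxFairMeso` with its `let`-chain packaged into `kickFluxSum`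
(definitional unfolding). -/
theorem kickFluxFairMeso_iff :
    KickFluxFairMeso ↔
      ∃ rs : ℕ → ℝ, (∀ N, 0 < rs N) ∧ Tendsto rs atTop (nhds 0) ∧
        Tendsto (fun N : ℕ => ((N : ℝ) + 1) * rs N ^ 3) atTop atTop ∧
        ∀ (a₀ θ₀ : T3 → ℝ) (u₀ : T3 → V3), Continuous a₀ → Continuous θ₀ → Continuous u₀ →
        (∀ x, 0 < a₀ x) → (∀ x, 0 < θ₀ x) → ∃ σ₀ : ℝ, 0 < σ₀ ∧ ∀ σ : ℝ, 0 < σ → σ < σ₀ →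
        ∀ Φ : (N : ℕ) → Flow σ N, ∀ τ : ℝ, 0 < τ →
        ∀ g : V3 × V3 × V3 → ℝ, Continuous g → (∃ C : ℝ, ∀ p, |g p| ≤ C) → ∀ δ : ℝ, 0 < δ →
        ∃ N₀ : ℕ, ∀ N : ℕ, N₀ ≤ N →
        ∀ h : Fin (N + 1) → ℕ → Past N × (ℝ × ℝ × ℝ) → ℝ, (∀ i n, Measurable (h i n)) →
        (∀ i n p, |h i n p| ≤ 1) →
        ∫⁻ z, ENNReal.ofReal |kickFluxSum σ N (Φ N) τ (rs N) g h z| ∂(localGibbsLaw σ a₀ u₀ θ₀ N (Φ N)) ≤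
          ENNReal.ofReal δ :=
  Iff.rfl

/-! ## §3 Reduction to the shielding witness -/

/-- (i) **The shielding kick test has flux mean zero** at every pair of incoming velocities: its flux-angular
integral vanishes for a transverse field (`zeroFluxMean_kickTest`), whatever the normalisation `Θ_1`. -/
theorem fluxMean_kickTest {c : V3 → V3 → V3} (hcb : ∀ v w, ⟪c v w, w - v⟫_ℝ = 0) (κ : ℝ) (vw : V3 × V3) :
    fluxMean (kickTest c κ) vw = 0 := by
  unfold fluxMean fluxAvg
  rw [zeroFluxMean_kickTest hcb κ vw.1 vw.2, mul_zero]

/-- (ii) **The shielding weight reads no cells**: on a coarse past `(Φ.coarsePastOf q i n z, j)` its value does not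
depend on the coarse-graining map `q` (it uses only the exact velocity components of the two snapshots and the
label `j`; the velocities of `coarseConfig q` are kept exact). Definitional. -/
theorem shieldWeight_coarsePastOf_eq {σ : ℝ} {N : ℕ} (Φ : Flow σ N) (c : V3 → V3 → V3) (K : ℝ)
    (i j : Fin (N + 1)) (m n : ℕ) (q q' : T3 → (Fin 3 → ℤ)) (z : Config (N + 1) (Fin 3) T3) :
    shieldWeight c K N i m (Φ.coarsePastOf q i n z, j) = shieldWeight c K N i m (Φ.coarsePastOf q' i n z, j) :=
  rfl

/-- (iii) **On the good set the compensated sum IS the shielding collision sum.** For the shielding test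
`kickTest c κ` (flux mean `0`, so the compensator drops) and the weight `p ↦ shieldWeight c K N i n p.1` (cell-blind,
so the `ρ`-coarse past may be traded for the `r`-coarse one), `kickFluxSum` at cell size `ρ` equals
`KickIsotropyInfoNegative.kickSum` at cell size `r` at every good initial datum. -/
theorem kickFluxSum_eq_kickSum {σ : ℝ} {N : ℕ} (Φ : Flow σ N) (τ ρ r : ℝ) {c : V3 → V3 → V3}
    (hcb : ∀ v w, ⟪c v w, w - v⟫_ℝ = 0) (κ K : ℝ) {z : Config (N + 1) (Fin 3) T3} (hz : z ∈ Φ.good) :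
    kickFluxSum σ N Φ τ ρ (kickTest c κ) (fun i n p => shieldWeight c K N i n p.1) z =
      kickSum σ N Φ τ r (kickTest c κ) (shieldWeight c K N) z := by
  unfold kickFluxSum kickSum
  simp only [hz, if_true, fluxMean_kickTest hcb, sub_zero,
    shieldWeight_coarsePastOf_eq Φ c K _ _ _ _ (Torus.coarseCell ρ) (Torus.coarseCell r) z]

/-- The two `L¹(local Gibbs law)` norms agree: the good set is conull for every local Gibbs law
(`ae_mem_good_localGibbsLaw`), and on it (iii) applies. -/
theorem lintegral_kickFluxSum_eq {σ : ℝ} (a₀ θ₀ : T3 → ℝ) (u₀ : T3 → V3) {N : ℕ} (Φ : Flow σ N)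
    (τ ρ r : ℝ) {c : V3 → V3 → V3} (hcb : ∀ v w, ⟪c v w, w - v⟫_ℝ = 0) (κ K : ℝ) :
    ∫⁻ z, ENNReal.ofReal |kickFluxSum σ N Φ τ ρ (kickTest c κ) (fun i n p => shieldWeight c K N i n p.1) z|
        ∂(localGibbsLaw σ a₀ u₀ θ₀ N Φ) =
      ∫⁻ z, ENNReal.ofReal |kickSum σ N Φ τ r (kickTest c κ) (shieldWeight c K N) z|
        ∂(localGibbsLaw σ a₀ u₀ θ₀ N Φ) := by
  refine lintegral_congr_ae ?_
  filter_upwards [ae_mem_good_localGibbsLaw σ a₀ u₀ θ₀ N Φ] with z hz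
  rw [kickFluxSum_eq_kickSum Φ τ ρ r hcb κ K hz]

/-! ## §4 The negative lemma `H → ¬ KickFluxFairMeso` -/

/-- **NEGATIVE LEMMA MODULO `H = ShieldingBiasPersists`: `H → ¬ KickFluxFairMeso`.** A persistent third-body
shielding bias under the invariant Gibbs law refutes absolute mesoscopic kick flux-fairness along every admissible
cell sequence: the shielding test and weight are admissible in `KickFluxFairMeso` (continuous, bounded by `1`;
measurable through `Prod.fst`, bounded by `1`), and by §3 the bound obtained is exactly the `KickBound` that `H`
denies for infinitely many `N`. -/
theorem KickFluxFairMeso_false_of_ShieldingBiasPersists (H : ShieldingBiasPersists) : ¬ KickFluxFairMeso := by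
  intro hF
  obtain ⟨rs, -, -, -, hall⟩ := kickFluxFairMeso_iff.1 hF
  obtain ⟨σ₀, hσ₀, hσ⟩ := hall (fun _ => 1) (fun _ => 1) (fun _ => 0) continuous_const continuous_const
    continuous_const (fun _ => one_pos) (fun _ => one_pos)
  obtain ⟨σ, hσpos, hσσ₀, Φ, τ, hτ, r, -, c, hc, hcb, κ, hκ, K, δ, hδ, hN⟩ := H σ₀ hσ₀
  obtain ⟨N₀, hN₀⟩ := hσ σ hσpos hσσ₀ Φ τ hτ (kickTest c κ) (continuous_kickTest hc hκ)
    ⟨1, abs_kickTest_le_one c hκ⟩ δ hδ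
  obtain ⟨N, hle, hnot⟩ := hN N₀
  have hS := hN₀ N hle (fun i n p => shieldWeight c K N i n p.1)
    (fun i n => (measurable_shieldWeight hc K N i n).comp measurable_fst)
    (fun i n p => abs_shieldWeight_le_one c K N i n p.1)
  exact hnot ((lintegral_kickFluxSum_eq (fun _ => 1) (fun _ => 1) (fun _ => 0) (Φ N) τ (rs N) r hcb κ
    K).ge.trans hS)

end Summit.AtomisticToContinuum.HydrodynamicLimit.Theorems.PercolationClosesChaos.Negative

end
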